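import Summits.Ventures.PercRepro0.BKFinite
import Summits.Ventures.PercRepro0.Pivotal

/-!
# P10 · BK-INCREASING in Lean, 2/2: the van den Berg–Kesten inequality on `Defs` (seat p2)

The disjoint-occurrence inequality for increasing events, kernel-checked on `Defs` (the cell's P10, used by the
R_MID-6 transfer, PLAN-plan-1-v4 §3 step (ii); the paper cites the PUBLISHED prints — this module is its Lean twin,
with no hypothesis and no print on the path).

**Statement.** For events `A`, `B` on configurations, `A ∘ B` (`DisjointOcc A B`) is the set of configurations `ω`
admitting two DISJOINT sets of bonds `K`, `L` such that every configuration agreeing with `ω` on `K` lies in `A` and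
every configuration agreeing with `ω` on `L` lies in `B` (AB87 p.503 ℓ17–21; the cylinder form `[ω]_K ⊆ A`,
`[ω]_L ⊆ B`).  If `A` and `B` are increasing and determined by a finite set of bonds `E`, then

  `P_p(A ∘ B) ≤ P_p(A) · P_p(B)`      (`setBernoulli_disjointOcc_le`, `P_disjointOcc_le`).

**Proof.** `BKFinite.locC_disjOcc_le` (the interpolation on the finite polynomial `locC`) is transferred through
`LocalLaw.setBernoulli_toReal_eq_locC`: `DisjointOcc A B` is determined by `E` when `A`, `B` are
(`determinedBy_disjointOcc`), and on the subsets of `E` it is `BKFinite.DisjOcc` (`coe_mem_disjointOcc_iff`).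

Where the INCREASING hypothesis enters: (a) `coe_mem_disjointOcc_iff` — the cylinder form is equivalent to the
open-witness form `BKFinite.DisjOcc` (two disjoint sets of OPEN bonds forcing `A`, resp. `B`) only for increasing
events; (b) `BKFinite.EK_self_iff` — at the end `K = E` of the interpolation the event is the product
`{𝒜 η} ∩ {ℬ η'}` only for monotone `𝒜`, `ℬ`. The one-coordinate step `BKFinite.step_pointwise` is purely
combinatorial on the open-witness form. In `DisjointOcc` the witness sets `K`, `L` range over all of `Set ι` (not
only bonds, not necessarily finite); for `A`, `B` determined by `E` a witness may be replaced by `K ∩ E`, `L ∩ E`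
(`mem_disjointOcc_of_agree`), so the event is the print's.

**Corollaries on `Defs`.** `P_disjointOcc_le` (events determined by a finite `E ⊆ 𝔼^d`);
`P_disjointOcc_boxConn_le`: `P_p({x ↔ y in Λ_n} ∘ {z ↔ w in Λ_n}) ≤ P_p(x ↔ y in Λ_n) · P_p(z ↔ w in Λ_n)`, the
two-arm input of R_MID-6 (ii); `mem_disjointOcc_of_walks`: two open walks with disjoint edge sets put `ω` in
`{x ↔ y} ∘ {z ↔ w}` (the inclusion behind the PATH FORM of HS90 (1.33), `n = 2`; `{x ↔ y}` on `ℤ^d` is not finitely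
determined, so the inequality itself is stated inside a box); `mem_disjointOcc_boxConn_of_walks`: the same inside
`Λ_n` — with `P_disjointOcc_boxConn_le` this is (1.33) for `n = 2` inside `Λ_n`, the instance R_MID-6 (ii) uses.

Namespace `Summit.Ventures.PercRepro0.BK`. Imports: `BKFinite` (the finite core), `Pivotal`
(`Sharp.boxBondsF = E(Λ_n)` as a finset ⊆ `𝔼^d`). Nothing here claims anything about `T(d)`.
-/

namespace Summit.Ventures.PercRepro0.BK

open MeasureTheory ProbabilityTheory unitInterval Set
open Summit.Ventures.PercRepro0.Defs
open Summit.Ventures.PercRepro0.Russo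
open Summit.Ventures.PercRepro0.BKFinite
open scoped ENNReal NNReal Classical

variable {ι : Type*}

/-! ### Disjoint occurrence of events on configurations -/

/-- `A ∘ B` (disjoint occurrence, AB87 Prop 3.4 / HS90 (1.33) in cylinder form): there are two disjoint sets of
bonds `K`, `L` such that every configuration agreeing with `ω` on `K` lies in `A` and every configuration agreeing
with `ω` on `L` lies in `B`. -/
def DisjointOcc (A B : Set (Set ι)) : Set (Set ι) :=
  {ω | ∃ K L : Set ι, Disjoint K L ∧ (∀ ω', (∀ e ∈ K, (e ∈ ω' ↔ e ∈ ω)) → ω' ∈ A) ∧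
      (∀ ω', (∀ e ∈ L, (e ∈ ω' ↔ e ∈ ω)) → ω' ∈ B)}

/-- Half of `determinedBy_disjointOcc`: disjoint occurrence transfers along agreement on `E`. -/
theorem mem_disjointOcc_of_agree {E : Set ι} {A B : Set (Set ι)} (hA : DeterminedBy E A)
    (hB : DeterminedBy E B) {ω₁ ω₂ : Set ι} (h : ∀ e ∈ E, (e ∈ ω₁ ↔ e ∈ ω₂))
    (h₁ : ω₁ ∈ DisjointOcc A B) : ω₂ ∈ DisjointOcc A B := by
  obtain ⟨K, L, hKL, hK, hL⟩ := h₁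
  refine ⟨K ∩ E, L ∩ E, hKL.mono Set.inter_subset_left Set.inter_subset_left, ?_, ?_⟩
  · intro ω' hω'
    have hmem : (ω' ∩ E) ∪ (ω₁ \ E) ∈ A := by
      refine hK _ fun e he => ?_
      by_cases heE : e ∈ E
      · have h1 := hω' e ⟨he, heE⟩
        have h2 := h e heE
        simp only [Set.mem_union, Set.mem_inter_iff, Set.mem_sdiff, heE, and_true, not_true_eq_false,
          and_false, or_false]
        rw [h1, h2]
      · simp only [Set.mem_union, Set.mem_inter_iff, Set.mem_sdiff, heE, and_false, false_or,
          not_false_eq_true, and_true]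
    exact (hA _ _ fun e he => by simp [Set.mem_union, Set.mem_inter_iff, Set.mem_sdiff, he]).1 hmem
  · intro ω' hω'
    have hmem : (ω' ∩ E) ∪ (ω₁ \ E) ∈ B := by
      refine hL _ fun e he => ?_
      by_cases heE : e ∈ E
      · have h1 := hω' e ⟨he, heE⟩
        have h2 := h e heE
        simp only [Set.mem_union, Set.mem_inter_iff, Set.mem_sdiff, heE, and_true, not_true_eq_false,
          and_false, or_false]
        rw [h1, h2]
      · simp only [Set.mem_union, Set.mem_inter_iff, Set.mem_sdiff, heE, and_false, false_or,
          not_false_eq_true, and_true]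
    exact (hB _ _ fun e he => by simp [Set.mem_union, Set.mem_inter_iff, Set.mem_sdiff, he]).1 hmem

/-- `A ∘ B` is determined by `E` when `A` and `B` are. -/
theorem determinedBy_disjointOcc {E : Set ι} {A B : Set (Set ι)} (hA : DeterminedBy E A)
    (hB : DeterminedBy E B) : DeterminedBy E (DisjointOcc A B) := fun _ _ h =>
  ⟨mem_disjointOcc_of_agree hA hB h, mem_disjointOcc_of_agree hA hB fun e he => (h e he).symm⟩

/-- On finite configurations, `A ∘ B` is `DisjOcc` of the restricted predicates (for increasing `A`, `B`). -/
theorem coe_mem_disjointOcc_iff {A B : Set (Set ι)} (hAup : IsUpperSet A) (hBup : IsUpperSet B)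
    (η : Finset ι) :
    (↑η : Set ι) ∈ DisjointOcc A B ↔
      DisjOcc (fun U : Finset ι => (↑U : Set ι) ∈ A) (fun V : Finset ι => (↑V : Set ι) ∈ B) η := by
  constructor
  · rintro ⟨K, L, hKL, hK, hL⟩
    refine ⟨η.filter (· ∈ K), η.filter (· ∈ L), Finset.filter_subset _ _, Finset.filter_subset _ _, ?_, ?_,
      ?_⟩
    · rw [Finset.disjoint_left]
      intro e he1 he2
      exact Set.disjoint_left.1 hKL (Finset.mem_filter.1 he1).2 (Finset.mem_filter.1 he2).2
    · refine hK _ fun e he => ?_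
      simp [he]
    · refine hL _ fun e he => ?_
      simp [he]
  · rintro ⟨U, V, hU, hV, hUV, hA, hB⟩
    refine ⟨↑U, ↑V, Finset.disjoint_coe.2 hUV, fun ω' hω' => hAup ?_ hA, fun ω' hω' => hBup ?_ hB⟩
    · show (↑U : Set ι) ⊆ ω'
      intro e he
      exact (hω' e he).2 (Finset.mem_coe.2 (hU (Finset.mem_coe.1 he)))
    · show (↑V : Set ι) ⊆ ω'
      intro e he
      exact (hω' e he).2 (Finset.mem_coe.2 (hV (Finset.mem_coe.1 he)))

/-- **The van den Berg–Kesten inequality** on `setBernoulli`: for increasing events `A`, `B` determined by a finite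
set `E ⊆ u`, `P(A ∘ B) ≤ P(A) · P(B)`. -/
theorem setBernoulli_disjointOcc_le [Countable ι] (u : Set ι) (p : I) (E : Finset ι)
    (hE : (↑E : Set ι) ⊆ u) {A B : Set (Set ι)} (hA : DeterminedBy (↑E) A) (hB : DeterminedBy (↑E) B)
    (hAup : IsUpperSet A) (hBup : IsUpperSet B) :
    setBernoulli u p (DisjointOcc A B) ≤ setBernoulli u p A * setBernoulli u p B := by
  have h1 := setBernoulli_toReal_eq_locC u p E hE (determinedBy_disjointOcc hA hB)
  have h2 := setBernoulli_toReal_eq_locC u p E hE hA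
  have h3 := setBernoulli_toReal_eq_locC u p E hE hB
  have hmonoA : ∀ η ζ : Finset ι, η ⊆ ζ → (↑η : Set ι) ∈ A → (↑ζ : Set ι) ∈ A :=
    fun _ _ h hη => hAup (Finset.coe_subset.2 h) hη
  have hmonoB : ∀ η ζ : Finset ι, η ⊆ ζ → (↑η : Set ι) ∈ B → (↑ζ : Set ι) ∈ B :=
    fun _ _ h hη => hBup (Finset.coe_subset.2 h) hη
  have key := locC_disjOcc_le E hmonoA hmonoB p.2.1 p.2.2
  have hcongr : locC E (fun η : Finset ι => (↑η : Set ι) ∈ DisjointOcc A B) p =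
      locC E (DisjOcc (fun U : Finset ι => (↑U : Set ι) ∈ A) (fun V : Finset ι => (↑V : Set ι) ∈ B)) p :=
    locC_congr E (fun η _ => coe_mem_disjointOcc_iff hAup hBup η) p
  have hreal : (setBernoulli u p (DisjointOcc A B)).toReal ≤
      (setBernoulli u p A).toReal * (setBernoulli u p B).toReal := by
    rw [h1, h2, h3, hcongr]
    exact key
  rw [← ENNReal.toReal_mul] at hreal
  exact (ENNReal.toReal_le_toReal (measure_ne_top _ _)
    (ENNReal.mul_ne_top (measure_ne_top _ _) (measure_ne_top _ _))).1 hreal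

/-! ### On `Defs`: percolation on `ℤ^d` -/

variable {d : ℕ}

/-- **P10 · BK-INCREASING on `Defs`**: for increasing events `A`, `B` determined by a finite set of bonds
`E ⊆ 𝔼^d`, `P_p(A ∘ B) ≤ P_p(A) · P_p(B)`. -/
theorem P_disjointOcc_le (p : I) {E : Finset (Sym2 (Vertex d))} (hE : (↑E : Set (Sym2 (Vertex d))) ⊆ bonds d)
    {A B : Set (Config d)} (hA : DeterminedBy (↑E) A) (hB : DeterminedBy (↑E) B) (hAup : IsUpperSet A)
    (hBup : IsUpperSet B) : P d p (DisjointOcc A B) ≤ P d p A * P d p B := by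
  unfold P
  exact setBernoulli_disjointOcc_le (bonds d) p E hE hA hB hAup hBup

/-- `{x ↔ y in Λ_n}` is determined by the bonds `E(Λ_n)` of the box. -/
theorem determinedBy_boxConn_boxBondsF (n : ℕ) (x y : Vertex d) :
    DeterminedBy (↑(Sharp.boxBondsF d n)) (boxConn d n x y) := by
  rw [Sharp.coe_boxBondsF]
  intro ω ω' h
  have hinter : (ω ∩ boxBonds d n) ∩ bonds d = (ω' ∩ boxBonds d n) ∩ bonds d := by
    ext e
    constructor
    · rintro ⟨⟨h1, h2⟩, h3⟩
      exact ⟨⟨(h e ⟨h3, h2⟩).1 h1, h2⟩, h3⟩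
    · rintro ⟨⟨h1, h2⟩, h3⟩
      exact ⟨⟨(h e ⟨h3, h2⟩).2 h1, h2⟩, h3⟩
  show Conn d (ω ∩ boxBonds d n) x y ↔ Conn d (ω' ∩ boxBonds d n) x y
  unfold Conn openGraph
  rw [hinter]

/-- `{x ↔ y in Λ_n}` is increasing. -/
theorem isUpperSet_boxConn (n : ℕ) (x y : Vertex d) : IsUpperSet (boxConn d n x y) :=
  fun _ _ h hω => conn_mono (Set.inter_subset_inter_left _ h) hω

/-- **Two arms in a box** (the R_MID-6 (ii) input):
`P_p({x ↔ y in Λ_n} ∘ {z ↔ w in Λ_n}) ≤ P_p(x ↔ y in Λ_n) · P_p(z ↔ w in Λ_n)`. -/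
theorem P_disjointOcc_boxConn_le (p : I) (n : ℕ) (x y z w : Vertex d) :
    P d p (DisjointOcc (boxConn d n x y) (boxConn d n z w)) ≤
      P d p (boxConn d n x y) * P d p (boxConn d n z w) :=
  P_disjointOcc_le p (Sharp.boxBondsF_subset_bonds n) (determinedBy_boxConn_boxBondsF n x y)
    (determinedBy_boxConn_boxBondsF n z w) (isUpperSet_boxConn n x y) (isUpperSet_boxConn n z w)

/-- **The path form** (HS90 (1.33) with `n = 2`): two open walks `x → y` and `z → w` with disjoint edge sets put the
configuration in `{x ↔ y} ∘ {z ↔ w}` — every configuration agreeing with `ω` on the edges of one walk keeps that walk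
open. -/
theorem mem_disjointOcc_of_walks {ω : Config d} {x y z w : Vertex d} (p₁ : (openGraph d ω).Walk x y)
    (p₂ : (openGraph d ω).Walk z w) (hdisj : Disjoint p₁.edges.toFinset p₂.edges.toFinset) :
    ω ∈ DisjointOcc {ω' | Conn d ω' x y} {ω' | Conn d ω' z w} := by
  refine ⟨↑p₁.edges.toFinset, ↑p₂.edges.toFinset, Finset.disjoint_coe.2 hdisj, ?_, ?_⟩
  · intro ω' hω'
    refine ⟨p₁.transfer (openGraph d ω') fun e he => ?_⟩
    have he' := p₁.edges_subset_edgeSet he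
    unfold openGraph at he' ⊢
    rw [SimpleGraph.edgeSet_fromEdgeSet] at he' ⊢
    exact ⟨⟨(hω' e (Finset.mem_coe.2 (List.mem_toFinset.2 he))).2 he'.1.1, he'.1.2⟩, he'.2⟩
  · intro ω' hω'
    refine ⟨p₂.transfer (openGraph d ω') fun e he => ?_⟩
    have he' := p₂.edges_subset_edgeSet he
    unfold openGraph at he' ⊢
    rw [SimpleGraph.edgeSet_fromEdgeSet] at he' ⊢
    exact ⟨⟨(hω' e (Finset.mem_coe.2 (List.mem_toFinset.2 he))).2 he'.1.1, he'.1.2⟩, he'.2⟩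

/-- The path form inside a box: two walks `x → y`, `z → w` in the open graph of `ω ∩ E(Λ_n)` with disjoint edge
sets put `ω` in `{x ↔ y in Λ_n} ∘ {z ↔ w in Λ_n}` (the pivotal split of R_MID-6 (ii) uses this with the two
segments of a self-avoiding open path through the pivotal bond). -/
theorem mem_disjointOcc_boxConn_of_walks {ω : Config d} {n : ℕ} {x y z w : Vertex d}
    (p₁ : (openGraph d (ω ∩ boxBonds d n)).Walk x y) (p₂ : (openGraph d (ω ∩ boxBonds d n)).Walk z w)
    (hdisj : Disjoint p₁.edges.toFinset p₂.edges.toFinset) :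
    ω ∈ DisjointOcc (boxConn d n x y) (boxConn d n z w) := by
  refine ⟨↑p₁.edges.toFinset, ↑p₂.edges.toFinset, Finset.disjoint_coe.2 hdisj, ?_, ?_⟩
  · intro ω' hω'
    refine ⟨p₁.transfer (openGraph d (ω' ∩ boxBonds d n)) fun e he => ?_⟩
    have he' := p₁.edges_subset_edgeSet he
    unfold openGraph at he' ⊢
    rw [SimpleGraph.edgeSet_fromEdgeSet] at he' ⊢
    exact ⟨⟨⟨(hω' e (Finset.mem_coe.2 (List.mem_toFinset.2 he))).2 he'.1.1.1, he'.1.1.2⟩, he'.1.2⟩, he'.2⟩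
  · intro ω' hω'
    refine ⟨p₂.transfer (openGraph d (ω' ∩ boxBonds d n)) fun e he => ?_⟩
    have he' := p₂.edges_subset_edgeSet he
    unfold openGraph at he' ⊢
    rw [SimpleGraph.edgeSet_fromEdgeSet] at he' ⊢
    exact ⟨⟨⟨(hω' e (Finset.mem_coe.2 (List.mem_toFinset.2 he))).2 he'.1.1.1, he'.1.1.2⟩, he'.1.2⟩, he'.2⟩

end Summit.Ventures.PercRepro0.BK
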